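import Summits.QuantumFields.BalabanUV.Beta.GAN24.FibreArrowBZ
import Summits.QuantumFields.BalabanUV.Beta.GAN24.Capacitance
import Summits.QuantumFields.BalabanUV.Beta.GAN24.CapacitanceClosedFormAlias

/-!
# `BalabanUV.Beta.GAN24.AliasFibreBridge` — binder row G-an2-4 / (CONV-C), road P1-fibre: THE BRIDGE between the dictionary side
# (`FibreArrow.aliasFibre`, proved to BE the Bloch fibre system) and the estimate side (`AliasObjects.fibreAl`, the swarm's binding currency T00)

NOT IN PRINT; OUR PROOF ATTEMPT.  HONEST FRAMING (cell contract, verbatim): «discharging `BetaPertH` makes Bałaban's UV stability UNCONDITIONAL — a real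
constructive-QFT result; it is NOT the continuum limit and NOT the Clay problem.»  HONEST DEPENDENCY (verbatim): «continuum YM on T⁴ ⇐ BetaPertH ∧ nine spine
estimates (0/9 proved); BetaPertH ⇐ (D1) ∧ (D4) ∧ CAP+tail; G-an2-4 gates asym, D1 and NE2/3/4.»  [folklore] finite bookkeeping over `ℂ` (no estimate, no cited fact,
no wall binder, no `def`).  NOT summit progress; nothing of (CONV-C)'s K-slot is discharged here.

## What is proved (generic `D`, `N ≥ 1`, COMPLEX quasi-momentum `p` unless stated)
* §1 box-sum factorisation `Σ_{z ∈ (ℤ/N)^D} pw k (repZ z) = Π_i gs (k_i) N` (`sum_pw_repZ_eq_prod_gs`, via `sum_zmod_val`), `pw_add_natMul_unitVec`;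
* §2 the four weight identifications `FibreArrow.sflat = AliasObjects.sbAl`, `boxS = SAl`, `chiHat = chiAl`, `boxSs = SAl·sAl` (`sflat_eq_sbAl`, `boxS_eq_SAl`,
  `chiHat_eq_chiAl`, `boxSs_eq_SAl_mul_sAl`);
* §3 **`aliasFibre_eq_fibreAl`**: `FibreArrow.aliasFibre p h = AliasObjects.fibreAl N p h` — ONE fibre datum; hence every statement of `GAN24/FibreArrow`,
  `GAN24/Capacitance`, `GAN24/FibInvClosedForm` (dictionary, invertibility, bordered inverse, `fibInv` closed form) reads verbatim in T00 currency, and conversely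
  every estimate on `fibreAl`/`cap N p` applies to the true fibre;
* §4 transfers: `fibreFun_eq_iff_arrowSolves_alias` (THE DICTIONARY in T00 currency), **`isUnit_cap_of_mem_BZ`**: `IsUnit (AliasObjects.cap N (ofRealVec q))` and
  `IsUnit (…).det` at EVERY `q ∈ BZ ∖ {0}` with NO scalar non-vanishing binder (an2's injectivity → `Capacitance.isUnit_capMat` → leaf-02's `cap_eq_capMat`);
* §5 **THE TRUE AMPLITUDES ARE T00's CLOSED FORMS** (K-slot sources = EL force `f̂` and Q-row source `ĉ`, no G/M sources): if `fibreFun (blochChar p) v = r` at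
  `p = ofRealVec q`, `q ∈ BZ ∖ {0}`, with `r (inr (inl z)) = 0` for all `z`, then `ampA p v = Ahat N p (srcEL p r) (r∘inr∘inr)`, `ampμ p v = muhat …`,
  `v (inr (inr κ)) = phiSol … κ`, and the box data are the synthesis `v (inl (κ,z)) = Σ_m Ahat … m κ · pw k_m (repZ z)` (`ampA_eq_Ahat`, `ampμ_eq_muhat`,
  `phi_eq_phiSol`, `boxData_eq_synth_Ahat`) — so bounds on `Ahat`/`phiSol`/`cSol` (rows Y09a, L08, L09) ARE bounds on `(fibreMatrix (blochChar p))⁻¹`.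
Unit `b2b-balaban-gan24-formalise-leaf-06` (G-an2-4 formalisation swarm), 2026-08-20.
-/

noncomputable section

open Complex Finset
open scoped BigOperators Real
open Literature.MathematicalPhysics.QuantumFieldTheory.Balaban1983to89
open Literature.MathematicalPhysics.QuantumFieldTheory.Balaban1983to89.Beta
open Literature.MathematicalPhysics.QuantumFieldTheory.LatticeForm (repZ)
open Literature.Probability.LatticeModels (TorusSite)
open AffineAveraging (Site unitVec)
open BlochFibreMatrix (Idx blochChar fibreFun fibreLin fibreLin_apply norm_blochChar_real)
open B4Strip (ofRealVec)
open B4ContourShift (BZ)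
open Summit.QuantumFields.BalabanUV.Beta.GAN24.FibreSymbols (pw dhat dflat lapSym pw_add_unitVec)
open Summit.QuantumFields.BalabanUV.Beta.GAN24.FibreBlockSolve (dot)
open Summit.QuantumFields.BalabanUV.Beta.GAN24.FibreDFT (kFine amp pw_zero_site)
open Summit.QuantumFields.BalabanUV.Beta.GAN24.FibreDFTDictionary (ampA ampμ)
open Summit.QuantumFields.BalabanUV.Beta.GAN24.FibreArrowRowsBloch (pw_natMul_unitVec)
open Summit.QuantumFields.BalabanUV.Beta.GAN24.FibreArrow (chiHat sflat boxS boxSs srcEL rG srcG aliasFibre fibreFun_eq_iff_arrowSolves)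
open Summit.QuantumFields.BalabanUV.Beta.GAN24.FibreArrowBZ (hL_of_mem_BZ)
open Summit.QuantumFields.BalabanUV.Beta.GAN24.Capacitance (capMat isUnit_capMat synthVec ampA_synthVec ampμ_synthVec amp_zero')
open Summit.QuantumFields.BalabanUV.Beta.GAN24.CapacitanceSolve (Fibre ArrowSolves)
open Summit.QuantumFields.BalabanUV.Beta.GAN24.AliasObjects
  (kAl gs sAl SAl sbAl SbAl chiAl dAl dbAl LAl fibreAl cap Ahat muhat phiSol cSol arrowSolves_closed)
open Summit.QuantumFields.BalabanUV.Beta.GAN24.CapacitanceClosedFormAlias (cap_eq_capMat)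

namespace Summit.QuantumFields.BalabanUV.Beta.GAN24.AliasFibreBridge

variable {D N : ℕ} [NeZero N]

/-! ## §1 Box sums of plane waves are products of geometric sums -/

/-- [folklore] Summing over `ℤ/N` through the representatives `0, …, N−1`. -/
theorem sum_zmod_val (f : ℕ → ℂ) : ∑ j : ZMod N, f j.val = ∑ t ∈ Finset.range N, f t := by
  refine Finset.sum_bij' (fun j _ => j.val) (fun t _ => (t : ZMod N)) ?_ ?_ ?_ ?_ ?_
  · intro j _; exact Finset.mem_range.mpr (ZMod.val_lt j)
  · intro t _; exact Finset.mem_univ _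
  · intro j _; exact ZMod.natCast_zmod_val j
  · intro t ht; exact ZMod.val_cast_of_lt (Finset.mem_range.mp ht)
  · intro j _; rfl

omit [NeZero N] in
/-- [folklore] A plane wave at a box representative factorises over the coordinates. -/
theorem pw_repZ_eq_prod (k : Fin D → ℂ) (z : TorusSite D N) : pw k (repZ z) = ∏ i, cexp (I * k i * ((z i).val : ℕ)) := by
  unfold pw
  rw [Finset.mul_sum, Complex.exp_sum]
  refine Finset.prod_congr rfl fun i _ => ?_
  simp only [repZ, Int.cast_natCast]
  ring_nf

/-- [folklore] **BOX-SUM FACTORISATION**: `Σ_{z ∈ (ℤ/N)^D} pw k (repZ z) = Π_i gs (k_i) N`. -/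
theorem sum_pw_repZ_eq_prod_gs (k : Fin D → ℂ) : ∑ z : TorusSite D N, pw k (repZ z) = ∏ i, gs (k i) N := by
  simp_rw [pw_repZ_eq_prod]
  rw [← Fintype.piFinset_univ, ← Finset.prod_univ_sum (fun _ => (Finset.univ : Finset (ZMod N))) fun i (j : ZMod N) => cexp (I * k i * ((j.val : ℕ) : ℂ))]
  refine Finset.prod_congr rfl fun i _ => ?_
  unfold gs
  exact sum_zmod_val (fun t => cexp (I * k i * (t : ℂ)))

omit [NeZero N] in
/-- [folklore] Site additivity along a coordinate axis: `pw k (x + s•e_κ) = pw k x · e^{i k_κ s}`. -/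
theorem pw_add_natMul_unitVec (k : Fin D → ℂ) (x : Site D) (κ : Fin D) (s : ℕ) :
    pw k (x + (s : ℤ) • unitVec κ) = pw k x * cexp (I * k κ * s) := by
  induction s with
  | zero => simp
  | succ n ih =>
    rw [Nat.cast_succ, add_smul, one_smul, ← add_assoc, pw_add_unitVec, ih]
    have e : cexp (I * k κ * ((n + 1 : ℕ) : ℂ)) = cexp (I * k κ) * cexp (I * k κ * (n : ℂ)) := by
      rw [← Complex.exp_add]; push_cast; ring_nf
    rw [e]
    ring

/-! ## §2 The weight identifications -/

/-- [folklore] `s♭_κ(m)`: `FibreArrow.sflat = AliasObjects.sbAl`. -/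
theorem sflat_eq_sbAl (p : Fin D → ℂ) (m : TorusSite D N) (κ : Fin D) : sflat p m κ = sbAl N p m κ := by
  unfold sflat sbAl gs
  refine Finset.sum_congr rfl fun s _ => ?_
  rw [pw_natMul_unitVec, Pi.neg_apply]

/-- [folklore] `S(m)`: `FibreArrow.boxS = AliasObjects.SAl`. -/
theorem boxS_eq_SAl (p : Fin D → ℂ) (m : TorusSite D N) : boxS p m = SAl N p m := by
  unfold boxS SAl sAl
  exact sum_pw_repZ_eq_prod_gs (kFine p m)

/-- [folklore] `S♭(m)` as a box sum: `Σ_z pw (−k_m) (repZ z) = SbAl`. -/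
theorem sum_pw_neg_eq_SbAl (p : Fin D → ℂ) (m : TorusSite D N) : ∑ z : TorusSite D N, pw (-kFine p m) (repZ z) = SbAl N p m := by
  unfold SbAl sbAl
  rw [sum_pw_repZ_eq_prod_gs]
  rfl

/-- [folklore] `χ̂(m)`: `FibreArrow.chiHat = AliasObjects.chiAl` (the box DFT of `1` is `S♭/N^D`). -/
theorem chiHat_eq_chiAl (p : Fin D → ℂ) (m : TorusSite D N) : chiHat p m = chiAl N p m := by
  unfold chiHat amp chiAl
  simp only [Pi.one_apply, one_mul, sum_pw_neg_eq_SbAl]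
  rw [div_eq_inv_mul]

/-- [folklore] `(S·s_κ)(m)`: `FibreArrow.boxSs = SAl · sAl` (site additivity + box-sum factorisation). -/
theorem boxSs_eq_SAl_mul_sAl (p : Fin D → ℂ) (m : TorusSite D N) (κ : Fin D) : boxSs p m κ = SAl N p m * sAl N p m κ := by
  unfold boxSs
  simp_rw [pw_add_natMul_unitVec, ← Finset.mul_sum]
  rw [← Finset.sum_mul, sum_pw_repZ_eq_prod_gs]
  rfl

/-! ## §3 One fibre datum -/

/-- [folklore] **`FibreArrow.aliasFibre p h = AliasObjects.fibreAl N p h`.** -/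
theorem aliasFibre_eq_fibreAl (p : Fin D → ℂ) (h : ∀ m : TorusSite D N, lapSym (kFine p m) ≠ 0) :
    aliasFibre p h = fibreAl N p h := by
  unfold aliasFibre fibreAl
  congr 1
  · funext m κ; rw [chiHat_eq_chiAl, sflat_eq_sbAl]
  · funext m; exact chiHat_eq_chiAl p m
  · funext m; exact boxS_eq_SAl p m
  · funext m κ; exact boxSs_eq_SAl_mul_sAl p m κ

/-! ## §4 Transfers to T00 currency -/

/-- [folklore] THE DICTIONARY in T00 currency: `fibreFun (blochChar p) v = r ↔ ∃ c, ArrowSolves (fibreAl N p h) (srcEL p r) (srcG p r) r_M r_Q Â μ̂ φ c`. -/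
theorem fibreFun_eq_iff_arrowSolves_alias (p : Fin D → ℂ) (h : ∀ m : TorusSite D N, lapSym (kFine p m) ≠ 0) (v r : Idx D N → ℂ) :
    fibreFun (⇑(blochChar p)) v = r ↔
      ∃ c : ℂ, ArrowSolves (fibreAl N p h) (srcEL p r) (srcG p r) (r (Sum.inr (Sum.inl 0))) (fun κ => r (Sum.inr (Sum.inr κ)))
        (ampA p v) (ampμ p v) (fun κ => v (Sum.inr (Sum.inr κ))) c := by
  rw [← aliasFibre_eq_fibreAl]
  exact fibreFun_eq_iff_arrowSolves p h v r

/-- [folklore] `capMat` of the alias fibre is invertible at every real quasi-momentum off `2πℤ^D` (no scalar binder): T00 currency. -/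
theorem isUnit_capMat_fibreAl (p : Fin D → ℂ) (hχ : ∀ a, ‖blochChar p a‖ = 1) (h : ∀ m : TorusSite D N, lapSym (kFine p m) ≠ 0) :
    IsUnit (capMat (fibreAl N p h)) := by
  rw [← aliasFibre_eq_fibreAl]
  exact isUnit_capMat p hχ h

/-- [folklore] **`AliasObjects.cap N p` IS INVERTIBLE AT EVERY `p = ofRealVec q`, `q ∈ BZ ∖ {0}`** — unconditionally (an2's injectivity of the fibre map). -/
theorem isUnit_cap_of_mem_BZ {q : Fin D → ℝ} (hq : q ∈ BZ D) (hq0 : q ≠ 0) :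
    IsUnit (cap N (ofRealVec q)) := by
  have hL : ∀ m : TorusSite D N, lapSym (kFine (ofRealVec q) m) ≠ 0 := hL_of_mem_BZ hq hq0
  rw [cap_eq_capMat N (ofRealVec q) hL]
  exact isUnit_capMat_fibreAl (ofRealVec q) (norm_blochChar_real q) hL

/-- [folklore] … hence `IsUnit (cap N (ofRealVec q)).det` — the `hdet` binder of T00's `capSolves_closed`/`arrowSolves_closed`, DISCHARGED on `BZ ∖ {0}`. -/
theorem isUnit_cap_det_of_mem_BZ {q : Fin D → ℝ} (hq : q ∈ BZ D) (hq0 : q ≠ 0) :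
    IsUnit (cap N (ofRealVec q)).det :=
  (Matrix.isUnit_iff_isUnit_det _).mp (isUnit_cap_of_mem_BZ hq hq0)

/-! ## §5 The true amplitudes are T00's closed forms (K-slot sources) -/

section Amplitudes

variable {q : Fin D → ℝ} (hq : q ∈ BZ D) (hq0 : q ≠ 0) {v r : Idx D N → ℂ}

/-- [folklore] With no G/M sources the G source in modes vanishes. -/
theorem srcG_eq_zero_of_noG (p : Fin D → ℂ) {r : Idx D N → ℂ} (hr : ∀ z : TorusSite D N, r (Sum.inr (Sum.inl z)) = 0) : srcG p r = 0 := by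
  funext m
  unfold srcG
  have : rG r = 0 := by
    funext z; by_cases hz : z = 0 <;> simp [rG, hz, hr]
  rw [this]
  exact amp_zero' p m

include hq hq0

/-- [folklore] **THE SOLUTION OF THE FIBRE SYSTEM IS THE SYNTHESIS OF T00's CLOSED FORMS.**  At `p = ofRealVec q`, `q ∈ BZ ∖ {0}`: if
`fibreFun (blochChar p) v = r` and `r` has no G/M sources, then `v = synthVec p (Ahat N p f̂ ĉ) (muhat N p f̂ ĉ) (phiSol N p f̂ ĉ)` with `f̂ = srcEL p r`,
`ĉ = r ∘ inr ∘ inr`. -/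
theorem eq_synthVec_closed (hv : fibreFun (⇑(blochChar (ofRealVec q))) v = r) (hr : ∀ z : TorusSite D N, r (Sum.inr (Sum.inl z)) = 0) :
    v = synthVec (ofRealVec q) (Ahat N (ofRealVec q) (srcEL (ofRealVec q) r) fun κ => r (Sum.inr (Sum.inr κ)))
          (muhat N (ofRealVec q) (srcEL (ofRealVec q) r) fun κ => r (Sum.inr (Sum.inr κ)))
          (phiSol N (ofRealVec q) (srcEL (ofRealVec q) r) fun κ => r (Sum.inr (Sum.inr κ))) := by
  set p : Fin D → ℂ := ofRealVec q with hp
  have hL : ∀ m : TorusSite D N, lapSym (kFine p m) ≠ 0 := hL_of_mem_BZ hq hq0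
  set fhat := srcEL p r with hf
  set chat : Fin D → ℂ := fun κ => r (Sum.inr (Sum.inr κ)) with hc
  set w := synthVec p (Ahat N p fhat chat) (muhat N p fhat chat) (phiSol N p fhat chat) with hw
  -- T00: the closed forms solve the arrow system (cap invertible on BZ ∖ {0})
  have harr := arrowSolves_closed N p hL (isUnit_cap_det_of_mem_BZ hq hq0) fhat chat
  -- hence the synthesised box data solve the fibre system with right-hand side r
  have hwr : fibreFun (⇑(blochChar p)) w = r := by
    rw [fibreFun_eq_iff_arrowSolves_alias p hL w r]
    refine ⟨cSol N p fhat chat, ?_⟩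
    rw [srcG_eq_zero_of_noG p hr, hr 0, ampA_synthVec, ampμ_synthVec]
    exact harr
  -- uniqueness (an2)
  have hinj := BlochFibreMatrix.fibreLin_injective (N := N) (blochChar p) (norm_blochChar_real q)
  have : v = w := hinj (by rw [fibreLin_apply, fibreLin_apply, hv, hwr])
  exact this

/-- [folklore] `Â = Ahat`: the `A`-amplitudes of the solution are T00's field amplitudes. -/
theorem ampA_eq_Ahat (hv : fibreFun (⇑(blochChar (ofRealVec q))) v = r) (hr : ∀ z : TorusSite D N, r (Sum.inr (Sum.inl z)) = 0) :
    ampA (ofRealVec q) v = Ahat N (ofRealVec q) (srcEL (ofRealVec q) r) fun κ => r (Sum.inr (Sum.inr κ)) := by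
  rw [eq_synthVec_closed hq hq0 hv hr, ampA_synthVec]

/-- [folklore] `μ̂ = muhat`. -/
theorem ampμ_eq_muhat (hv : fibreFun (⇑(blochChar (ofRealVec q))) v = r) (hr : ∀ z : TorusSite D N, r (Sum.inr (Sum.inl z)) = 0) :
    ampμ (ofRealVec q) v = muhat N (ofRealVec q) (srcEL (ofRealVec q) r) fun κ => r (Sum.inr (Sum.inr κ)) := by
  rw [eq_synthVec_closed hq hq0 hv hr, ampμ_synthVec]

/-- [folklore] `φ = phiSol`: the multiplier slot of the solution. -/
theorem phi_eq_phiSol (hv : fibreFun (⇑(blochChar (ofRealVec q))) v = r) (hr : ∀ z : TorusSite D N, r (Sum.inr (Sum.inl z)) = 0) (κ : Fin D) :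
    v (Sum.inr (Sum.inr κ)) = phiSol N (ofRealVec q) (srcEL (ofRealVec q) r) (fun κ => r (Sum.inr (Sum.inr κ))) κ := by
  rw [eq_synthVec_closed hq hq0 hv hr]
  rfl

/-- [folklore] BOX READOUT: `v (inl (κ, z)) = Σ_m Ahat … m κ · pw k_m (repZ z)` — the field legs of `(fibreMatrix (blochChar p))⁻¹ r`. -/
theorem boxData_eq_synth_Ahat (hv : fibreFun (⇑(blochChar (ofRealVec q))) v = r) (hr : ∀ z : TorusSite D N, r (Sum.inr (Sum.inl z)) = 0)
    (κ : Fin D) (z : TorusSite D N) :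
    v (Sum.inl (κ, z)) = ∑ m : TorusSite D N,
      Ahat N (ofRealVec q) (srcEL (ofRealVec q) r) (fun κ => r (Sum.inr (Sum.inr κ))) m κ * pw (kFine (ofRealVec q) m) (repZ z) := by
  rw [eq_synthVec_closed hq hq0 hv hr]
  rfl

end Amplitudes

end Summit.QuantumFields.BalabanUV.Beta.GAN24.AliasFibreBridge

end
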